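import Summits.AtomisticToContinuum.Crystallization.Theorems.FluxTubeKeplerFloorGivesLayered
import Summits.AtomisticToContinuum.Crystallization.Theorems.FluxTubeKeplerFluxCellKeplerSingleScale
import Summits.AtomisticToContinuum.Crystallization.Theorems.ChessboardParticlePlanesPeriodicWindowsIffCrystallization

/-!
# `InterlayerBlindRung` — F4 on-path lemma `S → Rung` (no `sorry`)

Forward rung over `FluxTubeKepler.FloorGivesLayered` (crux dir `FluxCellKepler`, stmt-AtomisticToContinuum-15221;
fwd-rung G1 gen 13).  Re-declares the rung family of `Lines/InterlayerBlindRung.lean` in the namespace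
`…SlabLadder.OnPath` and proves `slabRung_of_crystallization W : Crystallization → SlabRung W` for EVERY height
window `W`, hence `InterlayerBlindRung_of_Crystallization : Crystallization → InterlayerBlindRung` (tagged
`@[aesop safe apply]`, the rule the tribunal kernel's `S → C` probe closes with: `intro h; aesop`).  The proof is the
landed `ChessboardParticlePlanesPeriodicWindowsIffCrystallization.periodicWindows_of_crystallization` (periodic
windows along every Lennard-Jones ground-state sequence follow from `Crystallization`); the rung's hypotheses are not
even used, so the rung is ON THE PATH to `S` in the strongest sense.  Also here: the dial-monotonicity lemma
`slabRung_mono : W ⊆ W' → SlabRung W → SlabRung W'` (harder-to-easier direction) and the F3 member `slabRung_univ`.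
The [nec]-trap guard is discharged by the F3 witness (`Lines/InterlayerBlindRung_special.lean`): the rung is a
consequence of `S` pinned to a proved floor.
-/

noncomputable section

namespace Summit.AtomisticToContinuum.Crystallization.Cruxes.FluxCellKepler.SlabLadder.OnPath

open scoped BigOperators Classical
open Filter Topology
open Literature.MathematicalPhysics.StatisticalMechanics
open Summit.AtomisticToContinuum.Crystallization.Theorems.FluxCellKeplerSingleScale
  (LayeredGood layeredGood_mono)

local notation "E3" => EuclideanSpace ℝ (Fin 3)

/-- FLOOR(P₀): `N · e(P₀) ≤ E(x)` for every Lennard-Jones ground state (verbatim the floor's first hypothesis). -/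
def Floor (P₀ : PeriodicConfiguration 3) : Prop :=
  ∀ (N : ℕ) (x : Fin N → E3), IsGroundState lennardJones x →
    (N : ℝ) * P₀.energyPerParticle lennardJones ≤ interactionEnergy lennardJones x

/-- `W`-SLAB-GOOD SITE (the floor's goodness predicate with the window cut down to the height window `W`): some
admissible layered template (spacing `a ∈ [47/50, 1]`, rigid motion `A`, Hägg word `s`, Barlow registry, gaps in
`[39a/50, 17a/20]`) matches the configuration around `x i` two-way with tolerance `η` ON THE SLAB-BALL
`{v : ‖v‖ ≤ R, ⟪v, A (layerNormal 1)⟫ ∈ W}` — template points of the slab-ball are `η`-close to particles, particles of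
the slab-ball are `η`-close to template points.  `W = univ`: the floor's `LayeredGood R η` (`slabGood_univ_iff`). -/
def SlabGood (W : Set ℝ) (R η : ℝ) {N : ℕ} (x : Fin N → E3) (i : Fin N) : Prop :=
  ∃ a : ℝ, 47 / 50 ≤ a ∧ a ≤ 1 ∧ ∃ (A : E3 →ₗᵢ[ℝ] E3) (s : ℤ → ℤ) (z : ℤ → ℝ), IsHaggSeq s ∧
    (∀ m : ℤ, 39 / 50 * a ≤ z (m + 1) - z m ∧ z (m + 1) - z m ≤ 17 / 20 * a) ∧
    let S : Set E3 := {p | ∃ m k l : ℤ, p = A (((k : ℝ) • triangularVec₁ a) + ((l : ℝ) • triangularVec₂ a) +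
      ((haggLabel s m : ℝ) • barlowOffset a) + (z m • layerNormal 1))}
    (∀ p ∈ S, ‖p‖ ≤ R → inner ℝ p (A (layerNormal 1)) ∈ W → ∃ j : Fin N, dist (x j - x i) p ≤ η) ∧
    (∀ j : Fin N, ‖x j - x i‖ ≤ R → inner ℝ (x j - x i) (A (layerNormal 1)) ∈ W →
      ∃ p ∈ S, dist (x j - x i) p ≤ η)

/-- `W`-SLAB BUDGET: at every scale `(R,η)` some `c > 0` prices the sites that are not `W`-slab-good against the
excess energy over `N · e(P₀)` (`W = univ`: the floor's budget). -/
def SlabBudget (W : Set ℝ) (P₀ : PeriodicConfiguration 3) : Prop :=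
  ∀ R η : ℝ, 0 < R → 0 < η → ∃ c : ℝ, 0 < c ∧
    ∀ (N : ℕ) (x : Fin N → E3), IsGroundState lennardJones x →
      c * (Nat.card {i : Fin N // ¬ SlabGood W R η x i} : ℝ) ≤
        interactionEnergy lennardJones x - (N : ℝ) * P₀.energyPerParticle lennardJones

/-- Periodic windows at every scale along `x` (verbatim the conclusion of `FluxTubeKepler.PeriodicGivenLayered`). -/
def HasPeriodicWindows (x : (N : ℕ) → (Fin N → E3)) : Prop :=
  ∃ P : PeriodicConfiguration 3, ∀ R ε : ℝ, 0 < ε → ∃ᶠ N in atTop, ∃ t : E3,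
    (∀ s ∈ P.points, ‖s‖ ≤ R → ∃ i : Fin N, dist (x N i + t) s ≤ ε) ∧
    (∀ i : Fin N, ‖x N i + t‖ ≤ R → ∃ s ∈ P.points, dist (x N i + t) s ≤ ε)

/-- THE FAMILY `SlabRung W`: FLOOR(P₀) + the `W`-slab budget ⇒ periodic windows along every sequence of
Lennard-Jones ground states.  `W = univ` is the floor (`slabRung_univ`), smaller `W` = stronger rung
(`slabRung_mono`), `W = ∅` would make the budget vacuous (FLOOR alone ⇒ periodic windows: the summit's conjunct). -/
def SlabRung (W : Set ℝ) : Prop :=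
  ∀ P₀ : PeriodicConfiguration 3, Floor P₀ → SlabBudget W P₀ →
    ∀ x : (N : ℕ) → (Fin N → E3), (∀ N, IsGroundState lennardJones (x N)) → HasPeriodicWindows x

/-- **The deciding rung** `InterlayerBlindRung := SlabRung [-1/2, 1/2]`: the certificate only has to inspect the
THIN SLAB of half-height `1/2` (below every admissible gap `≥ 39/50 · 47/50`) around each site — i.e. to certify that
the site's own layer is a perfect triangular patch of radius `R` with empty half-slabs above and below; the stacking
data of adjacent layers (relative rotation, registry, gap, spacing mismatch) are never charged. -/
def InterlayerBlindRung : Prop := SlabRung (Set.Icc (-(1 / 2 : ℝ)) (1 / 2))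

/-! ## Bookkeeping: the floor is the member `W = univ`; monotonicity of the dial -/

/-- A larger height window asks more: `SlabGood` is antitone in `W`. -/
theorem slabGood_anti {W W' : Set ℝ} (hW : W ⊆ W') {R η : ℝ} {N : ℕ} (x : Fin N → E3) (i : Fin N) :
    SlabGood W' R η x i → SlabGood W R η x i := by
  rintro ⟨a, ha₁, ha₂, A, s, z, hs, hz, h₁, h₂⟩
  refine ⟨a, ha₁, ha₂, A, s, z, hs, hz, ?_, ?_⟩
  · intro p hp hpR hpW
    exact h₁ p hp hpR (hW hpW)
  · intro j hj hjW
    exact h₂ j hj (hW hjW)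

theorem layeredGood_of_slabGood_univ {R η : ℝ} {N : ℕ} (x : Fin N → E3) (i : Fin N) :
    SlabGood Set.univ R η x i → LayeredGood R η x i := by
  rintro ⟨a, ha₁, ha₂, A, s, z, hs, hz, h₁, h₂⟩
  refine ⟨a, ha₁, ha₂, A, s, z, hs, hz, ?_, ?_⟩
  · intro p hp hpR
    exact h₁ p hp hpR (Set.mem_univ _)
  · intro j hj
    exact h₂ j hj (Set.mem_univ _)

theorem slabGood_univ_of_layeredGood {R η : ℝ} {N : ℕ} (x : Fin N → E3) (i : Fin N) :
    LayeredGood R η x i → SlabGood Set.univ R η x i := by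
  rintro ⟨a, ha₁, ha₂, A, s, z, hs, hz, h₁, h₂⟩
  refine ⟨a, ha₁, ha₂, A, s, z, hs, hz, ?_, ?_⟩
  · intro p hp hpR _
    exact h₁ p hp hpR
  · intro j hj _
    exact h₂ j hj

/-- The floor's predicate is the member `W = univ` of the family. -/
theorem slabGood_univ_iff {R η : ℝ} {N : ℕ} (x : Fin N → E3) (i : Fin N) :
    SlabGood Set.univ R η x i ↔ LayeredGood R η x i :=
  ⟨layeredGood_of_slabGood_univ x i, slabGood_univ_of_layeredGood x i⟩

/-- `SlabGood W` is antitone in the radius and monotone in the tolerance. [folklore] -/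
theorem slabGood_mono_scale {W : Set ℝ} {R R' η η' : ℝ} (hR : R ≤ R') (hη : η' ≤ η) {N : ℕ}
    (x : Fin N → E3) (i : Fin N) : SlabGood W R' η' x i → SlabGood W R η x i := by
  rintro ⟨a, ha₁, ha₂, A, s, z, hs, hz, h₁, h₂⟩
  refine ⟨a, ha₁, ha₂, A, s, z, hs, hz, ?_, ?_⟩
  · intro p hp hpR hpW
    obtain ⟨j, hj⟩ := h₁ p hp (hpR.trans hR) hpW
    exact ⟨j, hj.trans hη⟩
  · intro j hj hjW
    obtain ⟨p, hp, hjp⟩ := h₂ j (hj.trans hR) hjW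
    exact ⟨p, hp, hjp.trans hη⟩

/-- The budget is antitone in the dial: a budget pricing the larger bad set prices the smaller one. -/
theorem slabBudget_anti {W W' : Set ℝ} (hW : W ⊆ W') (P₀ : PeriodicConfiguration 3) :
    SlabBudget W' P₀ → SlabBudget W P₀ := by
  intro hB R η hR hη
  obtain ⟨c, hc, hcB⟩ := hB R η hR hη
  refine ⟨c, hc, fun N x hx => le_trans ?_ (hcB N x hx)⟩
  have hle : Nat.card {i : Fin N // ¬ SlabGood W R η x i} ≤ Nat.card {i : Fin N // ¬ SlabGood W' R η x i} := by
    rw [Nat.card_eq_fintype_card, Nat.card_eq_fintype_card]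
    exact Fintype.card_subtype_mono _ _ fun i hi hg => hi (slabGood_anti hW x i hg)
  exact mul_le_mul_of_nonneg_left (by exact_mod_cast hle) hc.le

/-! ## F3 — the family specialises to the proved floor -/

/-- `SlabRung univ` is the floor: the seed theorem followed by the proved `PeriodicGivenLayered`. -/
theorem slabRung_univ : SlabRung Set.univ := by
  intro P₀ hF hB x hx
  refine Theses.FluxTubeKepler.PeriodicGivenLayered_holds x hx
    (Theorems.FluxTubeKeplerFloorGivesLayered.FloorGivesLayered_proof P₀ hF ?_ x hx)
  intro R η hR hη
  obtain ⟨c, hc, hcB⟩ := hB R η hR hη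
  refine ⟨c, hc, fun N y hy => ?_⟩
  show c * (Nat.card {i : Fin N // ¬ LayeredGood R η y i} : ℝ) ≤ _
  refine le_trans ?_ (hcB N y hy)
  have hle : Nat.card {i : Fin N // ¬ LayeredGood R η y i} ≤
      Nat.card {i : Fin N // ¬ SlabGood Set.univ R η y i} := by
    rw [Nat.card_eq_fintype_card, Nat.card_eq_fintype_card]
    exact Fintype.card_subtype_mono _ _ fun i hi hg => hi (layeredGood_of_slabGood_univ y i hg)
  exact mul_le_mul_of_nonneg_left (by exact_mod_cast hle) hc.le

/-! ## Dial monotonicity (harder-to-easier = enlarging the inspected height window `W`) -/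

theorem slabRung_mono {W W' : Set ℝ} (hW : W ⊆ W') : SlabRung W → SlabRung W' :=
  fun H P₀ hF hB x hx => H P₀ hF (slabBudget_anti hW P₀ hB) x hx

/-- The deciding rung gives back the floor member (informational `specialises`). -/
theorem slabRung_univ_of_interlayerBlindRung (h : InterlayerBlindRung) : SlabRung Set.univ :=
  slabRung_mono (Set.subset_univ _) h

/-! ## F4 — on-path lemmas: the sub-problem implies every member -/

theorem slabRung_of_crystallization (W : Set ℝ) (h : _root_.Crystallization) : SlabRung W :=
  fun _ _ _ x hx =>
    Theorems.ChessboardParticlePlanesPeriodicWindowsIffCrystallization.periodicWindows_of_crystallization h x hx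

@[aesop safe apply]
theorem InterlayerBlindRung_of_Crystallization (h : _root_.Crystallization) : InterlayerBlindRung :=
  slabRung_of_crystallization _ h


end Summit.AtomisticToContinuum.Crystallization.Cruxes.FluxCellKepler.SlabLadder.OnPath

end
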